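import Mathlib
import HarnessLib
import Summits.HubbardSuperconductivity.HubbardSuperconductivity.Theorems.KLProgrammeKLRegimeEngineThinCount2Doors
import Summits.HubbardSuperconductivity.HubbardSuperconductivity.Theorems.KLProgrammeKLRegimeEngineTowerImportP2FloorPlain

/-!
# Route `KLProgramme` — crux K3 ENGINE (stmt-HubbardSuperconductivity-20437 `KLRegimeEngineV17F2`), stub (b) v2 (ℓ): THE THREE IMPORT ROWS OF THE F-LAW FROM PLAIN LINES,
# IN THE SHAPES OF THE #20 DATA-SUPPLIER SPEC (pen (R352)(A): `ι₁ = i₁·(M/β)`, `ι₂′ = i₂·(M/β)³`, `X′ = x₆·(M/β)⁵`; cell gate-hubbard-kl, seat hubbard-kl-k3c2-p3 g15)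

WHY.  The floor-keyed law and its ∀j-assembly (`kernelNormsLevels_all_klEng[_sharp]`, p691583) carry, per block `k`, the import rows
`W·Z·klTowerMuLevF … d k 1 ≤ ι₁·λ_{dk}`, `W·Z²·klTowerMuLevF … d k 2 ≤ ι₂′·λ_{dk}`, `klTowerMuLevAtF … d 0 k 3 ≤ X′·λ_{dk}²`, and the numerics side («(ℓ)-NUMERICS», p4 g21)
discharges its doors M-uniformly exactly when `ι₁ = i₁·(M/β)`, `ι₂′ = i₂·(M/β)³`, `X′ = x₆·(M/β)⁵` with `i₁ i₂ x₆` free of `M, β`.  The row's floor suppliers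
(`klTowerMuLevF_one_le_floor_import_of_plainLine_klEng`, `klTowerMuLevF_two_le_floor_import_of_plainLine_klEng` p690069,
`klTowerMuLevAtF_zero_three_le_floor_import_of_plainLine_klEng` p690921) read PLAIN pinned `L¹` lines `S₂, S, S₆` of `𝒱_{dk}[K]` divided by `ε_x, ε_x³, ε_x⁵`
(`ε_x = imagTimeWeight β M = β/(2M)`), so the shapes hold as soon as the plain lines are given in the natural coupling units
`S₂ ≤ s₂·4^{−(dk−1)}·λ`, `S ≤ s₄·λ`, `S₆ ≤ s₆·λ²` (`s₂ s₄ s₆` free of `M, β` — E1's producer targets):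

* `inv_imagTimeWeight_pow` — `(ε_x^n)⁻¹ = (2·M/β)^n`;
* **`importRowsF_of_plainLines_klEng`** — `∃ CA > 0` (ONE transfer constant for all three rows): under the stub binders and the four count doors, for every block
  (`1 ≤ dk − 1 ≤ nScales β + 1`), all `W Z λ s₂ s₄ s₆ ≥ 0` and the three plain-line hypotheses, with the EQUATIONAL binders
  `i₁ = 1458·W·Z·klThinCount2C·CA²·s₂`, `i₂ = 8·W·Z²·(1458·klThinCountC + 531441·klThinCount3C)·CA⁴·s₄`, `x₆ = 3538944·klThinCount6C·CA⁶·s₆`: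
  `W·Z^1·klTowerMuLevF … d k 1 ≤ (i₁·(M/β))·λ ∧ W·Z^2·klTowerMuLevF … d k 2 ≤ (i₂·(M/β)^3)·λ ∧ klTowerMuLevAtF … d 0 k 3 ≤ (x₆·(M/β)^5)·λ²`.
Proofs only (arithmetic over the three landed suppliers); the plain lines stay hypotheses; nothing asserts (ℓ), any stub, K3 or superconductivity.
References: BGM 2006 §2.7 (2.71a), §2.8 (2.76)–(2.80), (2.96)–(2.98), Lemma 2.5 [cite: BenfattoGiulianiMastropietro2006].
-/

noncomputable section

namespace Summit.HubbardSuperconductivity.HubbardSuperconductivity.Theorems.EngineV8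

set_option linter.dupNamespace false -- summit = problem name (single-conjunct summit), D-0017

open Classical
open Real Finset Literature.MathematicalPhysics.QuantumLattice Literature.Probability.LatticeModels GrassmannAlgebra
open Literature.MathematicalPhysics.QuantumLattice.FermiRG
open Summit.HubbardSuperconductivity.HubbardSuperconductivity.Theorems.KLRegimeSplit
open Summit.HubbardSuperconductivity.HubbardSuperconductivity.Theorems.KLProgrammeLegKernels
open Summit.HubbardSuperconductivity.HubbardSuperconductivity.Theorems.DispersionFlow
open Summit.HubbardSuperconductivity.HubbardSuperconductivity.Theorems.KLRegimeWick

/-- `(ε_x^n)⁻¹ = (2·(M/β))^n` for `ε_x = imagTimeWeight β M = β/(2M)` (`β ≠ 0`, `M ≠ 0`). -/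
theorem inv_imagTimeWeight_pow {β : ℝ} (hβ : β ≠ 0) {M : ℕ} (hM : (M : ℝ) ≠ 0) (n : ℕ) :
    (imagTimeWeight β M ^ n)⁻¹ = (2 * ((M : ℝ) / β)) ^ n := by
  rw [← inv_pow]
  congr 1
  unfold imagTimeWeight
  field_simp

/-- **THE THREE IMPORT ROWS OF THE F-LAW FROM PLAIN LINES, IN THE #20 SHAPES** (see the module docstring): `∃ CA > 0` such that, under the stub binders (`P.WF`, `R.WF2`,
`c ≤ klEngC₃6`, `U ≤ klEngU₀9`, `klEngL₃`, `klEngM₃`, `FrameOK R U (nScales β) μ K`) and the four count doors, for every block with `1 ≤ dk − 1 ≤ nScales β + 1`, all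
`W Z λ s₂ s₄ s₆ ≥ 0`, the plain two-, four- and six-leg pinned `L¹` lines of `𝒱_{dk}[K]` bounded by `s₂·4^{−(dk−1)}·λ`, `s₄·λ`, `s₆·λ²`, and `i₁ i₂ x₆` the equational closed forms:
`W·Z^1·klTowerMuLevF … d k 1 ≤ (i₁·(M/β))·λ`, `W·Z^2·klTowerMuLevF … d k 2 ≤ (i₂·(M/β)^3)·λ`, `klTowerMuLevAtF … d 0 k 3 ≤ (x₆·(M/β)^5)·λ²`.
[cite: BenfattoGiulianiMastropietro2006, §2.7 (2.71a), §2.8 (2.96)-(2.98), Lemma 2.5] -/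
theorem importRowsF_of_plainLines_klEng :
    ∃ CA : ℝ, 0 < CA ∧ ∀ (P : SplitConsts) (R : RenConsts) (c : ℝ), P.WF → R.WF2 → 0 < c → c ≤ klEngC₃6 P R →
      c ≤ klThinCountC₃ R → c ≤ klThinCount3C₃ R → c ≤ klThinCount6C₃ R → c ≤ klThinCount2C₃ R →
      ∀ μ ∈ klWindowC, ∀ U : ℝ, 0 < U → U ≤ klEngU₀9 P R c →
      U ≤ klThinCountU₀ R → U ≤ klThinCount3U₀ R → U ≤ klThinCount6U₀ R → U ≤ klThinCount2U₀ R →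
      ∀ β : ℝ, klBetaMin ≤ β → β ≤ Real.exp (c / U ^ 2) →
      ∀ K : TrigPolyC4v, FrameOK R U (nScales β) μ K → ∀ (L M : ℕ) [NeZero L] [NeZero M],
      klEngL₃ β U ≤ L → klEngM₃ β U L ≤ M → ∀ d k : ℕ, 1 ≤ d * k - 1 → d * k - 1 ≤ nScales β + 1 →
      ∀ (W Z lam s₂ s₄ s₆ : ℝ), 0 ≤ W → 0 ≤ Z → 0 ≤ lam → 0 ≤ s₂ → 0 ≤ s₄ → 0 ≤ s₆ →
        (∀ (s c' : Fin 2 → Fin 2) (y₀ : SpaceTimeIdx L M),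
          fixedTupleL1 L M β 1 (sectorisedKernel L M β (trivialMultiplier L M) (klTowerInput L M β U μ K d k) 2)
            (fun i => (((0 : Fin 1), s i), c' i)) y₀ ≤ s₂ * ((4 : ℝ) ^ (d * k - 1))⁻¹ * lam) →
        (∀ (s c' : Fin 4 → Fin 2) (y₀ : SpaceTimeIdx L M),
          fixedTupleL1 L M β 3 (sectorisedKernel L M β (trivialMultiplier L M) (klTowerInput L M β U μ K d k) 4)
            (fun i => (((0 : Fin 1), s i), c' i)) y₀ ≤ s₄ * lam) →
        (∀ (s c' : Fin 6 → Fin 2) (y₀ : SpaceTimeIdx L M),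
          fixedTupleL1 L M β 5 (sectorisedKernel L M β (trivialMultiplier L M) (klTowerInput L M β U μ K d k) 6)
            (fun i => (((0 : Fin 1), s i), c' i)) y₀ ≤ s₆ * lam ^ 2) →
      ∀ (i₁ i₂ x₆ : ℝ), i₁ = 1458 * W * Z * klThinCount2C * CA ^ 2 * s₂ →
        i₂ = 8 * W * Z ^ 2 * (1458 * klThinCountC + 531441 * klThinCount3C) * CA ^ 4 * s₄ →
        x₆ = 3538944 * klThinCount6C * CA ^ 6 * s₆ →
      W * Z ^ 1 * klTowerMuLevF L M β U μ K d k 1 ≤ (i₁ * ((M : ℝ) / β)) * lam ∧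
      W * Z ^ 2 * klTowerMuLevF L M β U μ K d k 2 ≤ (i₂ * ((M : ℝ) / β) ^ 3) * lam ∧
      klTowerMuLevAtF L M β U μ K d 0 k 3 ≤ (x₆ * ((M : ℝ) / β) ^ 5) * lam ^ 2 := by
  obtain ⟨CA₁, hCA₁, h1⟩ := klTowerMuLevF_one_le_floor_import_of_plainLine_klEng
  obtain ⟨CA₂, hCA₂, h2⟩ := klTowerMuLevF_two_le_floor_import_of_plainLine_klEng
  obtain ⟨CA₃, hCA₃, h3⟩ := klTowerMuLevAtF_zero_three_le_floor_import_of_plainLine_klEng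
  refine ⟨max CA₁ (max CA₂ CA₃), lt_max_of_lt_left hCA₁, ?_⟩
  intro P R c hP hR2 hc hc6 hcT hcT3 hcT6 hcT2 μ hμ U hU hU9 hUT hUT3 hUT6 hUT2 β hβmin hβc K hK L M _ _ hL3 hM3 d k hn hnN
    W Z lam s₂ s₄ s₆ hW hZ hlam hs₂ hs₄ hs₆ hS₂ hS₄ hS₆ i₁ i₂ x₆ hi₁ hi₂ hx₆
  set CA := max CA₁ (max CA₂ CA₃) with hCAdef
  have hCA1 : CA₁ ≤ CA := le_max_left _ _
  have hCA2 : CA₂ ≤ CA := (le_max_left _ _).trans (le_max_right _ _)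
  have hCA3 : CA₃ ≤ CA := (le_max_right _ _).trans (le_max_right _ _)
  have hβ : 0 < β := KLRegimeSplit.pos_of_klBetaMin_le hβmin
  have hM0 : (0 : ℝ) < M := Nat.cast_pos.2 (Nat.pos_of_ne_zero (NeZero.ne M))
  have hε : 0 < imagTimeWeight β M := imagTimeWeight_pos_of_pos (M := M) hβ
  have hr : 0 < (M : ℝ) / β := div_pos hM0 hβ
  have hC2 : 0 ≤ klThinCount2C := klThinCount2C_pos.le
  have hC : 0 ≤ klThinCountC := klThinCountC_pos.le
  have hC3 : 0 ≤ klThinCount3C := klThinCount3C_pos.le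
  have hC6 : 0 ≤ klThinCount6C := klThinCount6C_pos.le
  have h4J : (0 : ℝ) < (4 : ℝ) ^ (d * k - 1) := by positivity
  have hinv : ∀ n : ℕ, (imagTimeWeight β M ^ n)⁻¹ = (2 * ((M : ℝ) / β)) ^ n :=
    fun n => inv_imagTimeWeight_pow hβ.ne' hM0.ne' n
  refine ⟨?_, ?_, ?_⟩
  · -- ι₁: two legs
    have hS0 : 0 ≤ s₂ * ((4 : ℝ) ^ (d * k - 1))⁻¹ * lam := by positivity
    have hrow := h1 P R c hP hR2 hc hc6 hcT2 μ hμ U hU hU9 hUT2 β hβmin hβc K hK L M hL3 hM3 d k hn hnN _ hS0 hS₂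
    have hval : 729 * klThinCount2C * (4 : ℝ) ^ (d * k - 1) * (CA₁ ^ 2 * (s₂ * ((4 : ℝ) ^ (d * k - 1))⁻¹ * lam)) / imagTimeWeight β M =
        1458 * klThinCount2C * CA₁ ^ 2 * s₂ * ((M : ℝ) / β) * lam := by
      rw [div_eq_mul_inv, ← pow_one (imagTimeWeight β M), hinv 1]
      field_simp
      ring
    rw [hval] at hrow
    have hpow : CA₁ ^ 2 ≤ CA ^ 2 := pow_le_pow_left₀ hCA₁.le hCA1 2
    calc W * Z ^ 1 * klTowerMuLevF L M β U μ K d k 1 ≤ W * Z ^ 1 * (1458 * klThinCount2C * CA₁ ^ 2 * s₂ * ((M : ℝ) / β) * lam) :=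
          mul_le_mul_of_nonneg_left hrow (by positivity)
      _ ≤ W * Z ^ 1 * (1458 * klThinCount2C * CA ^ 2 * s₂ * ((M : ℝ) / β) * lam) := by gcongr
      _ = (i₁ * ((M : ℝ) / β)) * lam := by subst hi₁; ring
  · -- ι₂′: four legs
    have hS0 : 0 ≤ s₄ * lam := by positivity
    have hrow := h2 P R c hP hR2 hc hc6 hcT hcT3 μ hμ U hU hU9 hUT hUT3 β hβmin hβc K hK L M hL3 hM3 d k hn hnN _ hS0 hS₄
    have hval : (1458 * klThinCountC + 531441 * klThinCount3C) * (CA₂ ^ 4 * (s₄ * lam)) / imagTimeWeight β M ^ 3 =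
        8 * (1458 * klThinCountC + 531441 * klThinCount3C) * CA₂ ^ 4 * s₄ * ((M : ℝ) / β) ^ 3 * lam := by
      rw [div_eq_mul_inv, hinv 3]
      ring
    rw [hval] at hrow
    have hpow : CA₂ ^ 4 ≤ CA ^ 4 := pow_le_pow_left₀ hCA₂.le hCA2 4
    calc W * Z ^ 2 * klTowerMuLevF L M β U μ K d k 2
        ≤ W * Z ^ 2 * (8 * (1458 * klThinCountC + 531441 * klThinCount3C) * CA₂ ^ 4 * s₄ * ((M : ℝ) / β) ^ 3 * lam) :=
          mul_le_mul_of_nonneg_left hrow (by positivity)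
      _ ≤ W * Z ^ 2 * (8 * (1458 * klThinCountC + 531441 * klThinCount3C) * CA ^ 4 * s₄ * ((M : ℝ) / β) ^ 3 * lam) := by gcongr
      _ = (i₂ * ((M : ℝ) / β) ^ 3) * lam := by subst hi₂; ring
  · -- X′: six legs, track 0
    have hS0 : 0 ≤ s₆ * lam ^ 2 := by positivity
    have hrow := h3 P R c hP hR2 hc hc6 hcT6 μ hμ U hU hU9 hUT6 β hβmin hβc K hK L M hL3 hM3 d k hn hnN _ hS0 hS₆
    have hval : 110592 * klThinCount6C * (CA₃ ^ 6 * (s₆ * lam ^ 2)) / imagTimeWeight β M ^ 5 =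
        3538944 * klThinCount6C * CA₃ ^ 6 * s₆ * ((M : ℝ) / β) ^ 5 * lam ^ 2 := by
      rw [div_eq_mul_inv, hinv 5]
      ring
    rw [hval] at hrow
    have hpow : CA₃ ^ 6 ≤ CA ^ 6 := pow_le_pow_left₀ hCA₃.le hCA3 6
    calc klTowerMuLevAtF L M β U μ K d 0 k 3 ≤ 3538944 * klThinCount6C * CA₃ ^ 6 * s₆ * ((M : ℝ) / β) ^ 5 * lam ^ 2 := hrow
      _ ≤ 3538944 * klThinCount6C * CA ^ 6 * s₆ * ((M : ℝ) / β) ^ 5 * lam ^ 2 := by gcongr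
      _ = (x₆ * ((M : ℝ) / β) ^ 5) * lam ^ 2 := by subst hx₆; ring

end Summit.HubbardSuperconductivity.HubbardSuperconductivity.Theorems.EngineV8

end
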